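import Literature.Analysis.FluidPDE.TaoFiniteEnergyLerayHopf
import Literature.Analysis.FluidPDE.PressureNormalisationNonnegViscosity
import HarnessLib

/-!
# Leray's energy identity for finite-energy classical solutions on `ℝ³`, every viscosity `ν ≥ 0`
# (incompressible Euler included): `½‖u(t)‖₂² + ν∫ₛᵗ‖∇u‖₂² = ½‖u(s)‖₂²`

Analysis/FluidPDE **proofs file** (theorems only: no definitions, no named facts, no `sorry`).
The tree's `IsClassicalNSSolutionOn.energyEq_of_finiteEnergy` (Tao 2013 Lemma 8.1 = Leray 1934
(3.4)) asks `ν > 0` only because its input `tao_pressure_normalisation` (Tao's Lemma 4.1 (i)) is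
printed for `ν > 0`; the localisation argument never divides by `ν`. With the `ν ≥ 0` normalisation
`IsClassicalNSSolutionOn.pressure_normalisation_of_nonneg_viscosity` the same proof (copied verbatim,
one line re-sourced) gives the identity for **every `ν ≥ 0`**; at `ν = 0` it is the conservation of
energy of smooth finite-energy Euler solutions with `∇u ∈ L²_{t,x}`, `u ∈ L³_{t,x}` (Majda–Bertozzi
2002, Prop. 1.13 (1.80); both integrability hypotheses are automatic in the Beale–Kato–Majda class on
bounded slabs). Consumers: the `ν ≥ 0` energy steps of the D-0090 claims cell
(`Literature.Claims.NS.Kyritsis2021.Step_2` = `Literature.Claims.NS.Kyritsis2017.Step_1`).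

* `IsClassicalNSSolutionOn.energyEq_of_finiteEnergy_nonneg` — the identity, `0 ≤ ν`;
* `IsClassicalNSSolutionOn.kineticEnergy_eq_of_euler` — `ν = 0`: `½‖u(t)‖₂² = ½‖u(s)‖₂²`.

References: J. Leray, Acta Math. 63 (1934) §17 (3.4) p. 220 [Leray1934]; T. Tao, Anal. PDE 6 (2013)
= arXiv:1108.1165, Lemma 8.1, Lemma 4.1 (i) [Tao2011]; A. J. Majda, A. L. Bertozzi, *Vorticity and
incompressible flow* (CUP 2002), Prop. 1.13 (1.80) p. 28 [MajdaBertozziCUP2002].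
-/

noncomputable section

open MeasureTheory Set Filter Topology
open scoped ENNReal NNReal RealInnerProductSpace

namespace Literature.Analysis.FluidPDE

variable {T ν : ℝ} {u : ℝ → (EuclideanSpace ℝ (Fin 3)) → (EuclideanSpace ℝ (Fin 3))}
  {p : ℝ → (EuclideanSpace ℝ (Fin 3)) → ℝ}

/-- **The energy identity for finite-energy classical solutions, every `ν ≥ 0`** (Leray 1934 (3.4);
Tao 2013 Lemma 8.1, sharp form; at `ν = 0` Majda–Bertozzi Prop. 1.13 (1.80)): for a classical solution
of the unforced system on `[0, T] × ℝ³`, `0 ≤ ν`, with `sup_t ∫|u(t)|² ≤ A < ⊤`, `∇u ∈ L²_{t,x}`,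
`u ∈ L³_{t,x}`, and `0 ≤ s ≤ t ≤ T`: `½‖u(t)‖₂² + ν∫ₛᵗ∫|∇u|²_F = ½‖u(s)‖₂²`. Proof: the tree's proof
of `energyEq_of_finiteEnergy` verbatim, the a.e. pressure representation `p(τ) = p̃[u(τ)] + C(τ)` taken
from `pressure_normalisation_of_nonneg_viscosity`, `X₅` from `tao2011_pressureTerm_estimate_holds`.
[cite: Tao2011, Lemma 8.1 (proof, §8, (54), (61)–(65))] [cite: MajdaBertozziCUP2002, Prop. 1.13 (1.80) p. 28] -/
theorem IsClassicalNSSolutionOn.energyEq_of_finiteEnergy_nonneg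
    (h : IsClassicalNSSolutionOn (Icc 0 T) ν 0 u p) (hν : 0 ≤ ν) (hT : 0 < T)
    {A : ℝ≥0∞} (hAt : A ≠ ⊤) (hA : ∀ t ∈ Icc 0 T, ∫⁻ x, ‖u t x‖ₑ ^ 2 ≤ A)
    (hgrad : ∫⁻ τ in Ioo 0 T, ∫⁻ x, ENNReal.ofReal (frobeniusNormSq (fderiv ℝ (u τ) x)) < ⊤)
    (hu₃ : ∫⁻ τ in Ioo 0 T, ∫⁻ x, ‖u τ x‖ₑ ^ (3 : ℕ) < ⊤)
    {s t : ℝ} (hs : 0 ≤ s) (hst : s ≤ t) (ht : t ≤ T) :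
    VectorCalculus.kineticEnergy (u t) +
      ν * (∫⁻ τ in Ioo s t, ∫⁻ x, ENNReal.ofReal (frobeniusNormSq (fderiv ℝ (u τ) x))).toReal =
      VectorCalculus.kineticEnergy (u s) := by
  have hX5 : FluidPDE.tao2011_pressureTerm_estimate := tao2011_pressureTerm_estimate_holds
  set b := stdOrthonormalBasis ℝ (EuclideanSpace ℝ (Fin 3))
  have hU : UniqueDiffOn ℝ (Icc 0 T) := uniqueDiffOn_Icc hT
  have htI : t ∈ Icc 0 T := ⟨hs.trans hst, ht⟩
  have hsI : s ∈ Icc 0 T := ⟨hs, hst.trans ht⟩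
  have hIcc : ∀ {τ}, τ ∈ Ioo s t → τ ∈ Icc 0 T := fun hτ => ⟨hs.trans hτ.1.le, hτ.2.le.trans ht⟩
  have hmem : ∀ τ ∈ Icc 0 T, MemLp (u τ) 2 volume := fun τ hτ =>
    memLp_two_of_lintegral_lt_top (h.contDiff_velocity hτ).continuous ((hA τ hτ).trans_lt hAt.lt_top)
  have hM : ∀ τ ∈ Icc 0 T, eEnergy (u τ) ≤ A := fun τ hτ => hA τ hτ
  -- joint continuity on `[s, t] × E`
  have hsub : Icc s t ×ˢ (univ : Set (EuclideanSpace ℝ (Fin 3))) ⊆ Icc 0 T ×ˢ univ :=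
    prod_mono (Icc_subset_Icc hs ht) Subset.rfl
  have cu : ContinuousOn (fun z : ℝ × (EuclideanSpace ℝ (Fin 3)) => u z.1 z.2) (Icc s t ×ˢ univ) :=
    h.smooth_velocity.continuousOn.mono hsub
  have cDu : ContinuousOn (fun z : ℝ × (EuclideanSpace ℝ (Fin 3)) => fderiv ℝ (u z.1) z.2) (Icc s t ×ˢ univ) :=
    (h.smooth_velocity.fderiv_slice hU).continuousOn.mono hsub
  -- the cut-offs
  obtain ⟨C, hC0', hfam⟩ := taoCutoff_family
  have hC0 : 0 ≤ C := hC0'.le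
  have hRpos : ∀ n : ℕ, (0 : ℝ) < n + 1 := fun n => Nat.cast_add_one_pos n
  set φ : ℕ → (EuclideanSpace ℝ (Fin 3)) → ℝ := fun n x => FluidPDE.taoCutoff (4 * ((n : ℝ) + 1)) ((n : ℝ) + 1) x ^ 8 with hφdef
  have hφ1 : ∀ n, ContDiff ℝ 1 (φ n) := fun n => (hfam n).1
  have hφc : ∀ n, HasCompactSupport (φ n) := fun n => (hfam n).2.1
  have hφle : ∀ n x, |φ n x| ≤ 1 := fun n => (hfam n).2.2.1
  have hφlim : ∀ x, Tendsto (fun n => φ n x) atTop (𝓝 1) := by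
    intro x
    obtain ⟨N, hN⟩ := exists_nat_ge (‖x‖ / 3)
    refine tendsto_atTop_of_eventually_const (i₀ := N) fun n hn => ?_
    refine (hfam n).2.2.2.1 x ?_
    have : (N : ℝ) ≤ n := by exact_mod_cast hn
    rw [div_le_iff₀ (by norm_num : (0 : ℝ) < 3)] at hN
    linarith
  have hDφv : ∀ n x v, |fderiv ℝ (φ n) x v| ≤ C / ((n : ℝ) + 1) * ‖v‖ := fun n => (hfam n).2.2.2.2
  have hc' : ∀ n : ℕ, (0 : ℝ) ≤ C / ((n : ℝ) + 1) := fun n => div_nonneg hC0 (hRpos n).le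
  have hrate : ∀ K : ℝ, Tendsto (fun n : ℕ => K * (1 / ((n : ℝ) + 1))) atTop (𝓝 0) := fun K => by
    simpa using (tendsto_one_div_add_atTop_nhds_zero_nat (𝕜 := ℝ)).const_mul K
  -- the identity for each `n`
  have hid := fun n => h.energy_balance_cutoff hT (hφ1 n) (hφc n) hs hst ht
  -- (a) the kinetic terms
  have limE : ∀ {r}, r ∈ Icc 0 T →
      Tendsto (fun n => 2⁻¹ * ∫ x, φ n x * ‖u r x‖ ^ 2) atTop (𝓝 (VectorCalculus.kineticEnergy (u r))) := by
    intro r hr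
    have hur : Continuous (u r) := (h.contDiff_velocity hr).continuous
    refine Tendsto.const_mul _ (tendsto_integral_of_dominated_convergence (fun x => ‖u r x‖ ^ 2)
      ?_ ((hmem r hr).integrable_norm_pow two_ne_zero) ?_ ?_)
    · exact fun n => ((hφ1 n).continuous.mul (hur.norm.pow 2)).aestronglyMeasurable
    · refine fun n => Eventually.of_forall fun x => ?_
      rw [Real.norm_eq_abs, abs_mul, abs_of_nonneg (sq_nonneg ‖u r x‖)]
      exact mul_le_of_le_one_left (sq_nonneg _) (hφle n x)
    · exact Eventually.of_forall fun x => by simpa using (hφlim x).mul_const (‖u r x‖ ^ 2)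
  -- (b) the transported kinetic energy `½ ∫∫ (Dφ·u)|u|²` is `O(1/n)`
  have lim1 : Tendsto (fun n => ∫ τ in Ioo s t, ∫ x, fderiv ℝ (φ n) x (u τ x) * ‖u τ x‖ ^ 2)
      atTop (𝓝 0) := by
    set L := ∫⁻ τ in Ioo 0 T, ∫⁻ x, ‖u τ x‖ₑ ^ (3 : ℕ) with hL
    have hLt : L ≠ ⊤ := hu₃.ne
    refine squeeze_zero_norm (a := fun n : ℕ => C * L.toReal * (1 / ((n : ℝ) + 1)))
      (fun n => ?_) (hrate _)
    have hpt : ∀ τ x, ‖fderiv ℝ (φ n) x (u τ x) * ‖u τ x‖ ^ 2‖ₑ ≤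
        ENNReal.ofReal (C / ((n : ℝ) + 1)) * ‖u τ x‖ₑ ^ (3 : ℕ) := fun τ x => by
      rw [Real.enorm_eq_ofReal_abs, ← ofReal_norm, ← ENNReal.ofReal_pow (norm_nonneg _),
        ← ENNReal.ofReal_mul (hc' n)]
      refine ENNReal.ofReal_le_ofReal ?_
      rw [abs_mul, abs_of_nonneg (sq_nonneg ‖u τ x‖)]
      calc |fderiv ℝ (φ n) x (u τ x)| * ‖u τ x‖ ^ 2
          ≤ C / ((n : ℝ) + 1) * ‖u τ x‖ * ‖u τ x‖ ^ 2 := by gcongr; exact hDφv n x _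
        _ = C / ((n : ℝ) + 1) * ‖u τ x‖ ^ 3 := by ring
    have hle : ∫⁻ τ in Ioo s t, ∫⁻ x, ‖fderiv ℝ (φ n) x (u τ x) * ‖u τ x‖ ^ 2‖ₑ ≤
        ENNReal.ofReal (C / ((n : ℝ) + 1)) * L := by
      calc ∫⁻ τ in Ioo s t, ∫⁻ x, ‖fderiv ℝ (φ n) x (u τ x) * ‖u τ x‖ ^ 2‖ₑ
          ≤ ∫⁻ τ in Ioo s t, ∫⁻ x, ENNReal.ofReal (C / ((n : ℝ) + 1)) * ‖u τ x‖ₑ ^ (3 : ℕ) :=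
            lintegral_mono fun τ => lintegral_mono fun x => hpt τ x
        _ = ENNReal.ofReal (C / ((n : ℝ) + 1)) * ∫⁻ τ in Ioo s t, ∫⁻ x, ‖u τ x‖ₑ ^ (3 : ℕ) := by
            simp only [lintegral_const_mul' _ _ ENNReal.ofReal_ne_top]
        _ ≤ ENNReal.ofReal (C / ((n : ℝ) + 1)) * L :=
            mul_le_mul_right (lintegral_Ioo_mono hs ht) _
    refine (norm_integral_integral_le_of_lintegral_le
      (G := fun z : ℝ × (EuclideanSpace ℝ (Fin 3)) => fderiv ℝ (φ n) z.2 (u z.1 z.2) * ‖u z.1 z.2‖ ^ 2)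
      (ENNReal.mul_ne_top ENNReal.ofReal_ne_top hLt) hle).trans_eq ?_
    rw [ENNReal.toReal_mul, ENNReal.toReal_ofReal (hc' n)]
    ring
  -- (c) the viscous cross term `ν ∫∫ Σᵢ ∂ᵢφ ⟪∂ᵢu, u⟫` is `O(1/n)` (Young's inequality)
  have lim3 : Tendsto (fun n => ∫ τ in Ioo s t, ∫ x, ∑ i, fderiv ℝ (φ n) x (b i) *
      ⟪fderiv ℝ (u τ) x (b i), u τ x⟫) atTop (𝓝 0) := by
    set Lg := ∫⁻ τ in Ioo 0 T, ∫⁻ x, ENNReal.ofReal (frobeniusNormSq (fderiv ℝ (u τ) x)) with hLg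
    set d : ℕ := (Finset.univ : Finset (Fin (Module.finrank ℝ (EuclideanSpace ℝ (Fin 3))))).card with hd
    set B : ℝ≥0∞ := Lg + (d : ℝ≥0∞) * A * ENNReal.ofReal T with hB
    have hBt : B ≠ ⊤ := ENNReal.add_ne_top.2 ⟨hgrad.ne, ENNReal.mul_ne_top
      (ENNReal.mul_ne_top (ENNReal.natCast_ne_top d) hAt) ENNReal.ofReal_ne_top⟩
    refine squeeze_zero_norm (a := fun n : ℕ => C * B.toReal * (1 / ((n : ℝ) + 1)))
      (fun n => ?_) (hrate _)
    -- pointwise Young bound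
    have hpt : ∀ τ x, ‖∑ i, fderiv ℝ (φ n) x (b i) * ⟪fderiv ℝ (u τ) x (b i), u τ x⟫‖ₑ ≤
        ENNReal.ofReal (C / ((n : ℝ) + 1)) *
          (ENNReal.ofReal (frobeniusNormSq (fderiv ℝ (u τ) x)) + d * ‖u τ x‖ₑ ^ 2) := by
      intro τ x
      have hreal : |∑ i, fderiv ℝ (φ n) x (b i) * ⟪fderiv ℝ (u τ) x (b i), u τ x⟫| ≤
          C / ((n : ℝ) + 1) * (frobeniusNormSq (fderiv ℝ (u τ) x) + d * ‖u τ x‖ ^ 2) := by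
        calc |∑ i, fderiv ℝ (φ n) x (b i) * ⟪fderiv ℝ (u τ) x (b i), u τ x⟫|
            ≤ ∑ i, |fderiv ℝ (φ n) x (b i) * ⟪fderiv ℝ (u τ) x (b i), u τ x⟫| :=
              Finset.abs_sum_le_sum_abs _ _
          _ ≤ ∑ i, C / ((n : ℝ) + 1) * (‖fderiv ℝ (u τ) x (b i)‖ ^ 2 + ‖u τ x‖ ^ 2) := by
              refine Finset.sum_le_sum fun i _ => ?_
              rw [abs_mul]
              have h1 : |fderiv ℝ (φ n) x (b i)| ≤ C / ((n : ℝ) + 1) := by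
                simpa [b.orthonormal.1 i] using hDφv n x (b i)
              have h2 : |⟪fderiv ℝ (u τ) x (b i), u τ x⟫| ≤
                  ‖fderiv ℝ (u τ) x (b i)‖ ^ 2 + ‖u τ x‖ ^ 2 :=
                (abs_real_inner_le_norm _ _).trans (by
                  nlinarith [sq_nonneg (‖fderiv ℝ (u τ) x (b i)‖ - ‖u τ x‖),
                    norm_nonneg (fderiv ℝ (u τ) x (b i)), norm_nonneg (u τ x)])
              exact mul_le_mul h1 h2 (abs_nonneg _) (hc' n)
          _ = C / ((n : ℝ) + 1) * (frobeniusNormSq (fderiv ℝ (u τ) x) + d * ‖u τ x‖ ^ 2) := by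
              rw [← Finset.mul_sum, Finset.sum_add_distrib, Finset.sum_const, nsmul_eq_mul,
                frobeniusNormSq_eq_sum b]
      rw [Real.enorm_eq_ofReal_abs]
      refine (ENNReal.ofReal_le_ofReal hreal).trans_eq ?_
      rw [ENNReal.ofReal_mul (hc' n), ENNReal.ofReal_add (frobeniusNormSq_nonneg _) (by positivity),
        ENNReal.ofReal_mul (Nat.cast_nonneg _), ENNReal.ofReal_natCast, ← ofReal_norm,
        ← ENNReal.ofReal_pow (norm_nonneg _)]
    -- inner integrals, `τ ∈ (s, t)`
    have hin : ∀ τ ∈ Ioo s t,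
        ∫⁻ x, ‖∑ i, fderiv ℝ (φ n) x (b i) * ⟪fderiv ℝ (u τ) x (b i), u τ x⟫‖ₑ ≤
          ENNReal.ofReal (C / ((n : ℝ) + 1)) *
            ((∫⁻ x, ENNReal.ofReal (frobeniusNormSq (fderiv ℝ (u τ) x))) + d * A) := by
      intro τ hτ
      have hτI := hIcc hτ
      have hmeas : AEMeasurable (fun x => ENNReal.ofReal (frobeniusNormSq (fderiv ℝ (u τ) x)))
          (volume : Measure (EuclideanSpace ℝ (Fin 3))) :=
        (ENNReal.continuous_ofReal.comp (LerayHopfProofs.continuous_frobeniusNormSq.comp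
          ((h.contDiff_velocity hτI).continuous_fderiv (by simp)))).aemeasurable
      calc ∫⁻ x, ‖∑ i, fderiv ℝ (φ n) x (b i) * ⟪fderiv ℝ (u τ) x (b i), u τ x⟫‖ₑ
          ≤ ∫⁻ x, ENNReal.ofReal (C / ((n : ℝ) + 1)) *
              (ENNReal.ofReal (frobeniusNormSq (fderiv ℝ (u τ) x)) + d * ‖u τ x‖ₑ ^ 2) :=
            lintegral_mono fun x => hpt τ x
        _ = ENNReal.ofReal (C / ((n : ℝ) + 1)) *
              ((∫⁻ x, ENNReal.ofReal (frobeniusNormSq (fderiv ℝ (u τ) x))) +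
                d * ∫⁻ x, ‖u τ x‖ₑ ^ 2) := by
            rw [lintegral_const_mul' _ _ ENNReal.ofReal_ne_top, lintegral_add_left' hmeas,
              lintegral_const_mul' _ _ (ENNReal.natCast_ne_top d)]
        _ ≤ ENNReal.ofReal (C / ((n : ℝ) + 1)) *
              ((∫⁻ x, ENNReal.ofReal (frobeniusNormSq (fderiv ℝ (u τ) x))) + d * A) := by
            gcongr
            exact hM τ hτI
    have hle : ∫⁻ τ in Ioo s t,
        ∫⁻ x, ‖∑ i, fderiv ℝ (φ n) x (b i) * ⟪fderiv ℝ (u τ) x (b i), u τ x⟫‖ₑ ≤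
          ENNReal.ofReal (C / ((n : ℝ) + 1)) * B := by
      calc ∫⁻ τ in Ioo s t, ∫⁻ x, ‖∑ i, fderiv ℝ (φ n) x (b i) * ⟪fderiv ℝ (u τ) x (b i), u τ x⟫‖ₑ
          ≤ ∫⁻ τ in Ioo s t, ENNReal.ofReal (C / ((n : ℝ) + 1)) *
              ((∫⁻ x, ENNReal.ofReal (frobeniusNormSq (fderiv ℝ (u τ) x))) + d * A) :=
            setLIntegral_mono' measurableSet_Ioo hin
        _ = ENNReal.ofReal (C / ((n : ℝ) + 1)) *
              ((∫⁻ τ in Ioo s t, ∫⁻ x, ENNReal.ofReal (frobeniusNormSq (fderiv ℝ (u τ) x))) +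
                d * A * volume (Ioo s t)) := by
            rw [lintegral_const_mul' _ _ ENNReal.ofReal_ne_top, lintegral_add_right _ measurable_const,
              setLIntegral_const]
        _ ≤ ENNReal.ofReal (C / ((n : ℝ) + 1)) * B := by
            rw [hB, Real.volume_Ioo]
            gcongr
            · exact lintegral_Ioo_mono hs ht
            · linarith
    refine (norm_integral_integral_le_of_lintegral_le
      (G := fun z : ℝ × (EuclideanSpace ℝ (Fin 3)) => ∑ i, fderiv ℝ (φ n) z.2 (b i) * ⟪fderiv ℝ (u z.1) z.2 (b i), u z.1 z.2⟫)
      (ENNReal.mul_ne_top ENNReal.ofReal_ne_top hBt) hle).trans_eq ?_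
    rw [ENNReal.toReal_mul, ENNReal.toReal_ofReal (hc' n)]
    ring
  -- (d) the pressure flux `∫∫ p (Dφ·u)`: Lemma 4.1 (i) and the estimate of `X₅`
  have lim4 : Tendsto (fun n => ∫ τ in Ioo s t, ∫ x, p τ x * fderiv ℝ (φ n) x (u τ x))
      atTop (𝓝 0) := by
    obtain ⟨Cf, -, -, hae⟩ := h.pressure_normalisation_of_nonneg_viscosity hν hT ⟨A, hAt.lt_top, hA⟩
    obtain ⟨C₅, hC₅0, h5⟩ := hX5
    set Ar : ℝ := Real.sqrt A.toReal with hAr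
    have hAr0 : 0 ≤ Ar := Real.sqrt_nonneg _
    have hAr2 : ENNReal.ofReal (Ar ^ 2) = A := by
      rw [hAr, Real.sq_sqrt ENNReal.toReal_nonneg, ENNReal.ofReal_toReal hAt]
    set G : ℝ → ℝ≥0∞ := fun τ => ∫⁻ x, ENNReal.ofReal (frobeniusNormSq (fderiv ℝ (u τ) x)) with hG
    set Dst : ℝ≥0∞ := ∫⁻ τ in Ioo s t, G τ with hDst
    have hDst : Dst ≠ ⊤ := ((lintegral_Ioo_mono hs ht).trans_lt hgrad).ne
    -- the slice bound, for a.e. `τ ∈ (s, t)` and every `ε > 0`, `n`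
    have hae' : ∀ᵐ τ ∂(volume.restrict (Ioo s t)), ∀ x, p τ x = FluidPDE.normalisedPressure (u τ) x + Cf τ :=
      ae_restrict_of_ae_restrict_of_subset (Ioo_subset_Icc_self.trans (Icc_subset_Icc hs ht)) hae
    have hslice : ∀ {ε : ℝ} (hε : 0 < ε) (n : ℕ), ∀ᵐ τ ∂(volume.restrict (Ioo s t)),
        ‖∫ x, p τ x * fderiv ℝ (φ n) x (u τ x)‖ₑ ≤
          ENNReal.ofReal ε * G τ +
            ENNReal.ofReal (C₅ * (ε * Ar ^ 2 / ((n : ℝ) + 1) ^ 2 + Ar ^ 6 / (ε ^ 3 * ((n : ℝ) + 1) ^ 4))) := by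
      intro ε hε n
      filter_upwards [hae', ae_restrict_mem measurableSet_Ioo] with τ hτ hτm
      have hτI := hIcc hτm
      have hv := h.contDiff_velocity hτI
      have hv1 : ContDiff ℝ 1 (u τ) := hv.of_le (by norm_cast)
      have heq := integral_pressure_shift_eq hv1 (h.divFree τ hτI) (hφ1 n) (hφc n)
        (h.contDiff_pressure hτI).continuous hτ
      have hr : (0 : ℝ) < (n : ℝ) + 1 := hRpos n
      have h5' := h5 (u τ) hv Ar hAr0 (by rw [hAr2]; exact hA τ hτI) (4 * ((n : ℝ) + 1)) ((n : ℝ) + 1)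
        hr (by linarith) ε hε
      have h5'' : |∫ x, FluidPDE.normalisedPressure (u τ) x * fderiv ℝ (φ n) x (u τ x)| ≤
          ε * FluidPDE.localisedDissipation (φ n) (u τ) +
            C₅ * (ε * Ar ^ 2 / ((n : ℝ) + 1) ^ 2 + Ar ^ 6 / (ε ^ 3 * ((n : ℝ) + 1) ^ 4)) := h5'
      rw [← heq] at h5''
      have hX : ENNReal.ofReal (FluidPDE.localisedDissipation (φ n) (u τ)) ≤ G τ :=
        ofReal_localisedDissipation_le hv1 (hφ1 n).continuous (hφc n)
          (fun x => FluidPDE.taoCutoff_pow_nonneg _ _ x 8) (fun x => FluidPDE.taoCutoff_pow_le_one _ _ x 8)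
      rw [Real.enorm_eq_ofReal_abs]
      refine (ENNReal.ofReal_le_ofReal h5'').trans ?_
      have hX0 : 0 ≤ ε * FluidPDE.localisedDissipation (φ n) (u τ) :=
        mul_nonneg hε.le (FluidPDE.localisedDissipation_nonneg (fun x => FluidPDE.taoCutoff_pow_nonneg _ _ x 8) _)
      rw [ENNReal.ofReal_add hX0 (by positivity), ENNReal.ofReal_mul hε.le]
      gcongr
    -- hence the bound on the time integral
    have hbound : ∀ {ε : ℝ} (hε : 0 < ε) (n : ℕ),
        |∫ τ in Ioo s t, ∫ x, p τ x * fderiv ℝ (φ n) x (u τ x)| ≤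
          ε * Dst.toReal +
            C₅ * (ε * Ar ^ 2 / ((n : ℝ) + 1) ^ 2 + Ar ^ 6 / (ε ^ 3 * ((n : ℝ) + 1) ^ 4)) * (t - s) := by
      intro ε hε n
      set K₂ : ℝ := C₅ * (ε * Ar ^ 2 / ((n : ℝ) + 1) ^ 2 + Ar ^ 6 / (ε ^ 3 * ((n : ℝ) + 1) ^ 4)) with hK₂
      have hK₂0 : 0 ≤ K₂ := by positivity
      have hle : ∫⁻ τ in Ioo s t, ‖∫ x, p τ x * fderiv ℝ (φ n) x (u τ x)‖ₑ ≤
          ENNReal.ofReal ε * Dst + ENNReal.ofReal K₂ * volume (Ioo s t) := by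
        calc ∫⁻ τ in Ioo s t, ‖∫ x, p τ x * fderiv ℝ (φ n) x (u τ x)‖ₑ
            ≤ ∫⁻ τ in Ioo s t, (ENNReal.ofReal ε * G τ + ENNReal.ofReal K₂) := lintegral_mono_ae (hslice hε n)
          _ = ENNReal.ofReal ε * Dst + ENNReal.ofReal K₂ * volume (Ioo s t) := by
              rw [lintegral_add_right _ measurable_const, lintegral_const_mul' _ _ ENNReal.ofReal_ne_top,
                setLIntegral_const]
      have hfin : ENNReal.ofReal ε * Dst + ENNReal.ofReal K₂ * volume (Ioo s t) ≠ ⊤ := by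
        rw [Real.volume_Ioo]
        exact ENNReal.add_ne_top.2 ⟨ENNReal.mul_ne_top ENNReal.ofReal_ne_top hDst,
          ENNReal.mul_ne_top ENNReal.ofReal_ne_top ENNReal.ofReal_ne_top⟩
      have h1 : ‖∫ τ in Ioo s t, ∫ x, p τ x * fderiv ℝ (φ n) x (u τ x)‖ ≤
          (ENNReal.ofReal ε * Dst + ENNReal.ofReal K₂ * volume (Ioo s t)).toReal := by
        refine (norm_integral_le_lintegral_norm _).trans (ENNReal.toReal_mono hfin ?_)
        refine le_trans (lintegral_mono fun τ => ?_) hle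
        rw [ofReal_norm]
      rw [Real.norm_eq_abs] at h1
      refine h1.trans_eq ?_
      rw [Real.volume_Ioo, ENNReal.toReal_add (ENNReal.mul_ne_top ENNReal.ofReal_ne_top hDst)
        (ENNReal.mul_ne_top ENNReal.ofReal_ne_top ENNReal.ofReal_ne_top), ENNReal.toReal_mul,
        ENNReal.toReal_mul, ENNReal.toReal_ofReal hε.le, ENNReal.toReal_ofReal hK₂0,
        ENNReal.toReal_ofReal (by linarith)]
    -- and the limit
    rw [Metric.tendsto_nhds]
    intro δ hδ
    set ε : ℝ := δ / (2 * (Dst.toReal + 1)) with hεdef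
    have hD0 : 0 ≤ Dst.toReal := ENNReal.toReal_nonneg
    have hε : 0 < ε := by positivity
    have hεD : ε * Dst.toReal ≤ δ / 2 := by
      rw [hεdef, div_mul_eq_mul_div, div_le_iff₀ (by positivity)]
      nlinarith
    have hsecond : Tendsto (fun n : ℕ =>
        C₅ * (ε * Ar ^ 2 / ((n : ℝ) + 1) ^ 2 + Ar ^ 6 / (ε ^ 3 * ((n : ℝ) + 1) ^ 4)) * (t - s))
        atTop (𝓝 0) := by
      have h0 : Tendsto (fun n : ℕ => (1 : ℝ) / ((n : ℝ) + 1)) atTop (𝓝 0) :=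
        tendsto_one_div_add_atTop_nhds_zero_nat
      have e : ∀ n : ℕ, C₅ * (ε * Ar ^ 2 / ((n : ℝ) + 1) ^ 2 + Ar ^ 6 / (ε ^ 3 * ((n : ℝ) + 1) ^ 4)) * (t - s) =
          C₅ * (ε * Ar ^ 2 * (1 / ((n : ℝ) + 1)) ^ 2 + Ar ^ 6 / ε ^ 3 * (1 / ((n : ℝ) + 1)) ^ 4) *
            (t - s) := by
        intro n
        have : (n : ℝ) + 1 ≠ 0 := (hRpos n).ne'
        field_simp
      simp_rw [e]
      have := ((((h0.pow 2).const_mul (ε * Ar ^ 2)).add ((h0.pow 4).const_mul (Ar ^ 6 / ε ^ 3))).const_mul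
        C₅).mul_const (t - s)
      simpa using this
    have hev : ∀ᶠ n : ℕ in atTop,
        |C₅ * (ε * Ar ^ 2 / ((n : ℝ) + 1) ^ 2 + Ar ^ 6 / (ε ^ 3 * ((n : ℝ) + 1) ^ 4)) * (t - s)| < δ / 2 := by
      have h2 := hsecond
      rw [Metric.tendsto_nhds] at h2
      simpa only [dist_zero_right, Real.norm_eq_abs] using h2 (δ / 2) (half_pos hδ)
    filter_upwards [hev] with n hn
    rw [dist_zero_right, Real.norm_eq_abs]
    calc |∫ τ in Ioo s t, ∫ x, p τ x * fderiv ℝ (φ n) x (u τ x)|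
        ≤ ε * Dst.toReal +
            C₅ * (ε * Ar ^ 2 / ((n : ℝ) + 1) ^ 2 + Ar ^ 6 / (ε ^ 3 * ((n : ℝ) + 1) ^ 4)) * (t - s) :=
          hbound hε n
      _ < δ := by
          linarith [le_abs_self (C₅ * (ε * Ar ^ 2 / ((n : ℝ) + 1) ^ 2 +
            Ar ^ 6 / (ε ^ 3 * ((n : ℝ) + 1) ^ 4)) * (t - s))]
  -- (e) the dissipation `ν ∫∫ φ |∇u|² → ν ∫∫ |∇u|²` (dominated convergence on `(s, t) × ℝ³`)
  set μ : Measure (ℝ × (EuclideanSpace ℝ (Fin 3))) := ((volume : Measure ℝ).restrict (Ioo s t)).prod (volume : Measure (EuclideanSpace ℝ (Fin 3)))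
    with hμ
  have lim2 : Tendsto (fun n => ∫ τ in Ioo s t, ∫ x, φ n x * frobeniusNormSq (fderiv ℝ (u τ) x))
      atTop (𝓝 ((∫⁻ τ in Ioo s t, ∫⁻ x,
        ENNReal.ofReal (frobeniusNormSq (fderiv ℝ (u τ) x))).toReal)) := by
    have cG : ContinuousOn (fun z : ℝ × (EuclideanSpace ℝ (Fin 3)) => frobeniusNormSq (fderiv ℝ (u z.1) z.2))
        (Icc s t ×ˢ univ) := LerayHopfProofs.continuous_frobeniusNormSq.comp_continuousOn cDu
    have hGi : Integrable (fun z : ℝ × (EuclideanSpace ℝ (Fin 3)) => frobeniusNormSq (fderiv ℝ (u z.1) z.2)) μ := by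
      refine integrable_prod_of_continuousOn_of_lintegral cG ?_
      calc ∫⁻ τ in Ioo s t, ∫⁻ x, ‖frobeniusNormSq (fderiv ℝ (u τ) x)‖ₑ
          = ∫⁻ τ in Ioo s t, ∫⁻ x, ENNReal.ofReal (frobeniusNormSq (fderiv ℝ (u τ) x)) := by
            simp only [Real.enorm_eq_ofReal (frobeniusNormSq_nonneg _)]
        _ ≤ ∫⁻ τ in Ioo 0 T, ∫⁻ x, ENNReal.ofReal (frobeniusNormSq (fderiv ℝ (u τ) x)) :=
            lintegral_Ioo_mono hs ht
        _ < ⊤ := hgrad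
    have hFn : ∀ n, Integrable (fun z : ℝ × (EuclideanSpace ℝ (Fin 3)) => φ n z.2 * frobeniusNormSq (fderiv ℝ (u z.1) z.2))
        μ := fun n =>
      hGi.mono' (aestronglyMeasurable_prod_of_continuousOn
        ((((hφ1 n).continuous.comp continuous_snd).continuousOn).mul cG))
        (Eventually.of_forall fun z => by
          rw [norm_mul, Real.norm_eq_abs, Real.norm_of_nonneg (frobeniusNormSq_nonneg _)]
          exact mul_le_of_le_one_left (frobeniusNormSq_nonneg _) (hφle n _))
    have hval : ∀ n, ∫ τ in Ioo s t, ∫ x, φ n x * frobeniusNormSq (fderiv ℝ (u τ) x) =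
        ∫ z, φ n z.2 * frobeniusNormSq (fderiv ℝ (u z.1) z.2) ∂μ := fun n =>
      (integral_prod _ (hFn n)).symm
    have hlimval : (∫⁻ τ in Ioo s t, ∫⁻ x, ENNReal.ofReal (frobeniusNormSq (fderiv ℝ (u τ) x))).toReal
        = ∫ z, frobeniusNormSq (fderiv ℝ (u z.1) z.2) ∂μ := by
      rw [integral_eq_lintegral_of_nonneg_ae (Eventually.of_forall fun z => frobeniusNormSq_nonneg _)
        hGi.aestronglyMeasurable, lintegral_prod _ hGi.aestronglyMeasurable.aemeasurable.ennreal_ofReal]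
    rw [hlimval]
    refine (tendsto_integral_of_dominated_convergence
      (fun z : ℝ × (EuclideanSpace ℝ (Fin 3)) => frobeniusNormSq (fderiv ℝ (u z.1) z.2))
      (fun n => (hFn n).aestronglyMeasurable) hGi (fun n => Eventually.of_forall fun z => ?_)
      (Eventually.of_forall fun z => ?_)).congr fun n => (hval n).symm
    · rw [norm_mul, Real.norm_eq_abs, Real.norm_of_nonneg (frobeniusNormSq_nonneg _)]
      exact mul_le_of_le_one_left (frobeniusNormSq_nonneg _) (hφle n _)
    · simpa using (hφlim z.2).mul_const (frobeniusNormSq (fderiv ℝ (u z.1) z.2))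
  -- (f) no force
  have lim5 : Tendsto (fun n => ∫ τ in Ioo s t, ∫ x, φ n x * ⟪(0 : ℝ → (EuclideanSpace ℝ (Fin 3)) → (EuclideanSpace ℝ (Fin 3))) τ x, u τ x⟫)
      atTop (𝓝 0) := by
    simp only [Pi.zero_apply, inner_zero_left, mul_zero, integral_zero]
    exact tendsto_const_nhds
  -- (g) pass to the limit in the identity
  have hLHS := (limE htI).sub (limE hsI)
  have hRHS := ((((lim1.const_mul (2⁻¹ : ℝ)).sub (lim2.const_mul ν)).sub (lim3.const_mul ν)).add
    lim4).add lim5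
  have heq := tendsto_nhds_unique hLHS (hRHS.congr fun n => (hid n).symm)
  linarith

/-- **Conservation of energy for smooth finite-energy Euler solutions** (`ν = 0`):
`½‖u(t)‖₂² = ½‖u(s)‖₂²` for `0 ≤ s ≤ t ≤ T`, for a classical solution of the incompressible Euler
equations on `[0, T] × ℝ³` with finite energy, `∇u ∈ L²_{t,x}` and `u ∈ L³_{t,x}`.
[cite: MajdaBertozziCUP2002, Prop. 1.13 (1.80) p. 28] -/
theorem IsClassicalNSSolutionOn.kineticEnergy_eq_of_euler
    (h : IsClassicalNSSolutionOn (Icc 0 T) 0 0 u p) (hT : 0 < T)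
    {A : ℝ≥0∞} (hAt : A ≠ ⊤) (hA : ∀ t ∈ Icc 0 T, ∫⁻ x, ‖u t x‖ₑ ^ 2 ≤ A)
    (hgrad : ∫⁻ τ in Ioo 0 T, ∫⁻ x, ENNReal.ofReal (frobeniusNormSq (fderiv ℝ (u τ) x)) < ⊤)
    (hu₃ : ∫⁻ τ in Ioo 0 T, ∫⁻ x, ‖u τ x‖ₑ ^ (3 : ℕ) < ⊤)
    {s t : ℝ} (hs : 0 ≤ s) (hst : s ≤ t) (ht : t ≤ T) :
    VectorCalculus.kineticEnergy (u t) = VectorCalculus.kineticEnergy (u s) := by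
  have hid := h.energyEq_of_finiteEnergy_nonneg le_rfl hT hAt hA hgrad hu₃ hs hst ht
  simpa using hid

end Literature.Analysis.FluidPDE

end
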